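import Literature.MathematicalPhysics.QuantumLattice.SpinGaugedFlatSectorBounds
import HarnessLib

/-!
# The `g → 0⁺` (Born–Oppenheimer) descent of block pair order to the flat `Q₈` sector

Family `hubbard` (trunk T-QLATTICE). For the `Q₈`-spin-gauged Hubbard torus
`H_g(L, U) = spinGaugedHubbardTorus L U g = A + g² E' + g⁻² M'` (`SpinGaugedHubbardTorus`,
`spinGaugedHubbardTorusWith_eq_add`: `A = Σ_k H_F(k) ⊗ |k⟩⟨k|` the block-diagonal gauge–fermion part,
`E' = 1 ⊗ Σ_b E_b ≥ 0` the electric term, `M' = 1 ⊗ Σ_p w_p` the magnetic term, `w_p ∈ {0,1,2}` with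
`Σ_p w_p(k) ≥ 1` unless the link configuration `k` is FLAT) at FIXED side `L`, the theorem
`SpinGauged.q8_flatSector_descent` proves: if along the whole corridor `g ∈ (0, g₀]` every ground state
`ψ` of the `N_L`-particle block (`N_L = 2⌊(1-δ)L²/2⌋`, all Gauss sectors) has transported-singlet pair
order `c'·L⁴·‖ψ‖² ≤ ⟨ψ, Δ^g†Δ^g ψ⟩`, then there are a flat configuration `k` MINIMISING the `N_L`-sector
ground energy `e₀(k)` of the frozen-link Hamiltonian `H_F(k) = A|_{(·,k)(·,k)}` among flat configurations
and an `N_L`-sector ground state `φ` of `H_F(k)` (`H_F(k) φ = e₀(k) φ`, `φ ≠ 0`) with frozen pair order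
`c'·L⁴·‖φ‖² ≤ ⟨φ, P_k†P_k φ⟩`, `P_k = Δ^g|_{(·,k)(·,k)}`. (The statement is kept in the quantifier
shape of route ColourTheSpin's crux `SgEndpoint`, stub S1, of `HubbardSuperconductivity`, which it
serves; the hypotheses `0 < U`, `L₁ ≤ L`, `Even L` are only passed through.)

PROOF (finite-dimensional singular perturbation at fixed `L`; Kogut–Susskind's weak-coupling limit).
Let `e⋆ = min_{k flat} e₀(k)` (attained at `k₀`, unit frozen ground state `φ₀`), `a₀ = E₀(A)`,
`c_E = |Bond L|(1 - 1/8)`. For a unit block ground state `Ψ` at coupling `g ≤ g₀`: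
`E_g = Re⟨Ψ,HΨ⟩ ≤ Re⟨φ₀⊗k₀, H φ₀⊗k₀⟩ = e⋆ + g² c_E` (trial state); hence
(i) `Σ_{k not flat} ‖Ψ_k‖² ≤ Re⟨Ψ,M'Ψ⟩ ≤ g² C₁`, (ii) the flat defect
`D(Ψ) = Σ_{k flat} (Re⟨Ψ_k,H_F(k)Ψ_k⟩ - e⋆‖Ψ_k‖²) ≤ g² C₂` with each summand `≥ 0`, and (iii) the
hypothesis gives `Re⟨Ψ, Δ†Δ Ψ⟩ ≥ c'L⁴`. Along `g_n = g₀/(n+2)` a subsequence of unit block ground states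
converges (compact unit sector) to `a`: unit, block-supported, `a_k = 0` off the flat configurations,
every flat defect term of `a` vanishes, and `Re⟨a, Δ†Δ a⟩ ≥ c'L⁴ = c'L⁴ Σ_k ‖a_k‖²`. Since
`Δ†Δ = Σ_k P_k†P_k ⊗ |k⟩⟨k|`, some `k` with `a_k ≠ 0` has `Re⟨a_k, P_k†P_k a_k⟩ ≥ c'L⁴‖a_k‖²`; this `k` is
flat, `e₀(k) ≤ e⋆ ≤ e₀(k)` makes it a flat minimiser, and the variational principle on the invariant
`N_L`-particle sector (`EigenvalueContinuation.mulVec_eq_smul_of_forall_le_on`) turns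
`Re⟨a_k,H_F(k)a_k⟩ = e₀(k)‖a_k‖²` into `H_F(k) a_k = e₀(k) a_k`.

No definitions. Sources: J. Kogut, L. Susskind, Phys. Rev. D 11 (1975) 395 §IV (the magnetic term
dominates at weak coupling and pins the links to zero flux); T. Kato, *Perturbation Theory for Linear
Operators*, II §5 (finite-dimensional analytic/singular perturbation) — here replaced by the
elementary variational sandwich; all statements are folklore.

## Mathlib / tree search

Mathlib: `IsCompact.tendsto_subseq`, `Finset.exists_min_image`, `Finset.exists_subset_card_eq`,
`Tendsto.div_atTop`. Tree (REUSED): `SpinGaugedBlockCalculus`, `SpinGaugedFlatSectorBounds`,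
`SectorVariationalBounds`, `EigenvalueContinuation.*`; no `g → 0` reduction existed (lean search
'flatSector|bornOppenheimer|descent.*gauge': nothing).
-/

noncomputable section

namespace Literature.MathematicalPhysics.QuantumLattice

open Matrix Finset Filter _root_.Topology GaugedHubbard
open scoped Kronecker ComplexOrder

namespace SpinGauged

/-- The particle number `N_L = 2⌊(1-δ)L²/2⌋` fits into the `2L²` spin-orbitals: the `N_L`-block is
non-trivial (`δ ∈ (0, 1/2)`). [folklore] -/
theorem exists_card_orb_eq_blockNumber (L : ℕ) {δ : ℝ} (hδ : δ ∈ Set.Ioo (0 : ℝ) (1 / 2)) :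
    ∃ s : Finset (Orb (FermionTorus 2 L)), s.card = 2 * ⌊(1 - δ) * (L : ℝ) ^ 2 / 2⌋₊ := by
  have hcard : Fintype.card (Orb (FermionTorus 2 L)) = L ^ 2 * 2 := by
    simp [FermionTorus, Fintype.card_prod, Fintype.card_fin, Lex]
  have hle : 2 * ⌊(1 - δ) * (L : ℝ) ^ 2 / 2⌋₊ ≤ L ^ 2 * 2 := by
    have h1 : (⌊(1 - δ) * (L : ℝ) ^ 2 / 2⌋₊ : ℝ) ≤ (1 - δ) * (L : ℝ) ^ 2 / 2 :=
      Nat.floor_le (by nlinarith [hδ.1, hδ.2, sq_nonneg (L : ℝ)])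
    have h2 : (1 - δ) * (L : ℝ) ^ 2 / 2 ≤ (L : ℝ) ^ 2 := by nlinarith [hδ.1, hδ.2, sq_nonneg (L : ℝ)]
    have h3 : ((2 * ⌊(1 - δ) * (L : ℝ) ^ 2 / 2⌋₊ : ℕ) : ℝ) ≤ ((L ^ 2 * 2 : ℕ) : ℝ) := by
      push_cast
      nlinarith
    exact_mod_cast h3
  obtain ⟨s, -, hs⟩ := Finset.exists_subset_card_eq (s := (Finset.univ : Finset (Orb (FermionTorus 2 L))))
    (n := 2 * ⌊(1 - δ) * (L : ℝ) ^ 2 / 2⌋₊) (by rw [Finset.card_univ, hcard]; exact hle)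
  exact ⟨s, hs⟩

/-- **The `g → 0⁺` descent of block pair order to the flat `Q₈` sector.** If for all
`g ∈ (0, g₀]` (and all even `L ≥ L₁`) every ground state of the `N_L`-particle block of the
`Q₈`-spin-gauged torus `H_g(L,U)` has transported-singlet pair order `≥ c'·L⁴·‖ψ‖²`, then for every such
`L` there are a FLAT configuration `k` minimising the `N_L`-sector frozen ground energy among flat
configurations and an `N_L`-sector ground state `φ` of `H_F(k)` with frozen pair order `≥ c'·L⁴·‖φ‖²`.
See the module docstring for the proof. Kogut–Susskind, PRD 11 (1975) 395 §IV (weak-coupling limit);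
finite-dimensional singular perturbation at fixed `L`. [folklore] -/
theorem q8_flatSector_descent :
    ∀ (U δ g₀ c' : ℝ) (L₁ : ℕ), 0 < U → δ ∈ Set.Ioo (0 : ℝ) (1 / 2) → 0 < g₀ → 0 < c' →
      (∀ g : ℝ, 0 < g → g ≤ g₀ → ∀ (L : ℕ) [NeZero L], L₁ ≤ L → Even L →
        ∀ ψ : {ik : SpinGauged.Index L Q8 //
            SpinGauged.HasParticleNumber L (2 * ⌊(1 - δ) * (L : ℝ) ^ 2 / 2⌋₊) ik} → ℂ,
          (ψ ≠ 0 ∧ ∃ E : ℝ, (spinGaugedHubbardTorus L U g).toBlock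
              (SpinGauged.HasParticleNumber L (2 * ⌊(1 - δ) * (L : ℝ) ^ 2 / 2⌋₊))
              (SpinGauged.HasParticleNumber L (2 * ⌊(1 - δ) * (L : ℝ) ^ 2 / 2⌋₊)) *ᵥ ψ = (E : ℂ) • ψ ∧
            ∀ φ : {ik : SpinGauged.Index L Q8 //
                SpinGauged.HasParticleNumber L (2 * ⌊(1 - δ) * (L : ℝ) ^ 2 / 2⌋₊) ik} → ℂ,
              E * (star φ ⬝ᵥ φ).re ≤ (star φ ⬝ᵥ (spinGaugedHubbardTorus L U g).toBlock
                (SpinGauged.HasParticleNumber L (2 * ⌊(1 - δ) * (L : ℝ) ^ 2 / 2⌋₊))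
                (SpinGauged.HasParticleNumber L (2 * ⌊(1 - δ) * (L : ℝ) ^ 2 / 2⌋₊)) *ᵥ φ).re) →
          c' * (L : ℝ) ^ 4 * (star ψ ⬝ᵥ ψ).re ≤
            (star ψ ⬝ᵥ ((spinGaugedPairField L)ᴴ * spinGaugedPairField L).toBlock
                (SpinGauged.HasParticleNumber L (2 * ⌊(1 - δ) * (L : ℝ) ^ 2 / 2⌋₊))
                (SpinGauged.HasParticleNumber L (2 * ⌊(1 - δ) * (L : ℝ) ^ 2 / 2⌋₊)) *ᵥ ψ).re) →
      ∀ (L : ℕ) [NeZero L], L₁ ≤ L → Even L →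
        ∃ k : GaugedHubbard.Bond L → Q8,
          ((∀ x : FermionTorus 2 L, SpinGauged.holonomy L k x = 1) ∧
            ∀ k' : GaugedHubbard.Bond L → Q8, (∀ x : FermionTorus 2 L, SpinGauged.holonomy L k' x = 1) →
              (Matrix.of fun s s' => spinGaugedHubbardTorusWith Q8.rep L U 0 0 (s, k) (s', k)).minEnergyOn
                  (nParticleSubmodule (2 * ⌊(1 - δ) * (L : ℝ) ^ 2 / 2⌋₊) :
                    Submodule ℂ (Fock (Orb (FermionTorus 2 L)))) ≤
                (Matrix.of fun s s' => spinGaugedHubbardTorusWith Q8.rep L U 0 0 (s, k') (s', k')).minEnergyOn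
                  (nParticleSubmodule (2 * ⌊(1 - δ) * (L : ℝ) ^ 2 / 2⌋₊) :
                    Submodule ℂ (Fock (Orb (FermionTorus 2 L))))) ∧
          ∃ φ : Fock (Orb (FermionTorus 2 L)),
            (φ ∈ (nParticleSubmodule (2 * ⌊(1 - δ) * (L : ℝ) ^ 2 / 2⌋₊) :
                Submodule ℂ (Fock (Orb (FermionTorus 2 L)))) ∧ φ ≠ 0 ∧
              (Matrix.of fun s s' => spinGaugedHubbardTorusWith Q8.rep L U 0 0 (s, k) (s', k)) *ᵥ φ =
                ((((Matrix.of fun s s' => spinGaugedHubbardTorusWith Q8.rep L U 0 0 (s, k) (s', k)).minEnergyOn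
                  (nParticleSubmodule (2 * ⌊(1 - δ) * (L : ℝ) ^ 2 / 2⌋₊) :
                    Submodule ℂ (Fock (Orb (FermionTorus 2 L)))) : ℝ) : ℂ) • φ)) ∧
              c' * (L : ℝ) ^ 4 * (star φ ⬝ᵥ φ).re ≤
                (star φ ⬝ᵥ ((Matrix.of fun s s' => spinGaugedPairField L (s, k) (s', k))ᴴ *
                    (Matrix.of fun s s' => spinGaugedPairField L (s, k) (s', k))) *ᵥ φ).re := by
  intro U δ g₀ c' L₁ _hU hδ hg₀ _hc hC L _ hL hEven
  classical
  /- ───── objects ───── -/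
  set N : ℕ := 2 * ⌊(1 - δ) * (L : ℝ) ^ 2 / 2⌋₊ with hNdef
  set A : Matrix (Index L Q8) (Index L Q8) ℂ := spinGaugedHubbardTorusWith Q8.rep L U 0 0 with hAdef
  set E' : Matrix (Index L Q8) (Index L Q8) ℂ :=
    (1 : Matrix (Finset (Orb (FermionTorus 2 L))) (Finset (Orb (FermionTorus 2 L))) ℂ) ⊗ₖ (electric L : Matrix (Bond L → Q8) _ ℂ)
    with hE'def
  set M' : Matrix (Index L Q8) (Index L Q8) ℂ :=
    (1 : Matrix (Finset (Orb (FermionTorus 2 L))) (Finset (Orb (FermionTorus 2 L))) ℂ) ⊗ₖ magnetic Q8.rep L with hM'def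
  set HF : (Bond L → Q8) → Matrix (Finset (Orb (FermionTorus 2 L))) (Finset (Orb (FermionTorus 2 L))) ℂ :=
    fun k => A.submatrix (fun s => (s, k)) (fun s => (s, k)) with hHFdef
  set W : Submodule ℂ (Fock (Orb (FermionTorus 2 L))) := nParticleSubmodule N with hWdef
  set e₀ : (Bond L → Q8) → ℝ := fun k => (HF k).minEnergyOn W with he₀def
  set P : Matrix (Index L Q8) (Index L Q8) ℂ := spinGaugedPairField L with hPdef
  set PF : (Bond L → Q8) → Matrix (Finset (Orb (FermionTorus 2 L))) (Finset (Orb (FermionTorus 2 L))) ℂ :=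
    fun k => P.submatrix (fun s => (s, k)) (fun s => (s, k)) with hPFdef
  have hρ := Q8.star_trace_rep
  have hN : ∃ s : Finset (Orb (FermionTorus 2 L)), s.card = N := exists_card_orb_eq_blockNumber L hδ
  -- the goal in these terms (everything is definitional)
  suffices hgoal : ∃ k : Bond L → Q8, ((∀ x, holonomy L k x = 1) ∧
      ∀ k', (∀ x, holonomy L k' x = 1) → e₀ k ≤ e₀ k') ∧
      ∃ φ : Fock (Orb (FermionTorus 2 L)), (φ ∈ W ∧ φ ≠ 0 ∧ HF k *ᵥ φ = ((e₀ k : ℝ) : ℂ) • φ) ∧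
        c' * (L : ℝ) ^ 4 * (star φ ⬝ᵥ φ).re ≤ (star φ ⬝ᵥ ((PF k)ᴴ * PF k) *ᵥ φ).re by
    exact hgoal
  /- ───── Hamiltonian facts ───── -/
  have hAherm : A.IsHermitian := isHermitian_spinGaugedHubbardTorusWith Q8.rep L hρ U 0 0
  have hHsplit : ∀ g : ℝ, spinGaugedHubbardTorus L U g =
      A + ((g ^ 2 : ℝ) : ℂ) • E' + ((1 / g ^ 2 : ℝ) : ℂ) • M' := fun g =>
    spinGaugedHubbardTorusWith_eq_add Q8.rep L U _ _
  have hAdiag : A = linkDiag HF := spinGaugedHubbardTorusWith_zero_zero_eq_linkDiag_submatrix Q8.rep L U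
  have hPPdiag : Pᴴ * P = linkDiag (fun k => (PF k)ᴴ * PF k) := pairOrder_eq_linkDiag_submatrix Q8.rep L
  -- quadratic forms over the link configuration
  have hformA : ∀ v : Index L Q8 → ℂ, (star v ⬝ᵥ A *ᵥ v).re =
      ∑ k, (star (fun s => v (s, k)) ⬝ᵥ HF k *ᵥ (fun s => v (s, k))).re := by
    intro v
    conv_lhs => rw [hAdiag, star_dotProduct_linkDiag_mulVec]
    rw [Complex.re_sum]
  have hformPP : ∀ v : Index L Q8 → ℂ, (star v ⬝ᵥ (Pᴴ * P) *ᵥ v).re =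
      ∑ k, (star (fun s => v (s, k)) ⬝ᵥ ((PF k)ᴴ * PF k) *ᵥ (fun s => v (s, k))).re := by
    intro v
    conv_lhs => rw [hPPdiag, star_dotProduct_linkDiag_mulVec]
    rw [Complex.re_sum]
  have hnorm : ∀ v : Index L Q8 → ℂ, (star v ⬝ᵥ v).re =
      ∑ k, (star (fun s => v (s, k)) ⬝ᵥ (fun s => v (s, k))).re := by
    intro v
    rw [star_dotProduct_self_eq_sum_link, Complex.re_sum]
  /- ───── the flat minimiser `k₀`, `e⋆`, the unit frozen ground state `φ₀` ───── -/
  obtain ⟨k₀, hk₀flat, hk₀min⟩ : ∃ k₀ : Bond L → Q8, (∀ x, holonomy L k₀ x = 1) ∧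
      ∀ k', (∀ x, holonomy L k' x = 1) → e₀ k₀ ≤ e₀ k' := by
    obtain ⟨k₀, hk₀, hmin⟩ := Finset.exists_min_image
      (Finset.univ.filter fun k : Bond L → Q8 => ∀ x, holonomy L k x = 1) e₀
      ⟨1, by simp⟩
    refine ⟨k₀, (Finset.mem_filter.1 hk₀).2, fun k' hk' => hmin k' (Finset.mem_filter.2 ⟨Finset.mem_univ _, hk'⟩)⟩
  set estar : ℝ := e₀ k₀ with hestar
  obtain ⟨φ₀, hφ₀W, hφ₀unit, hφ₀eig⟩ := exists_unit_groundState_frozen Q8.rep L hρ U k₀ hN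
  have hφ₀energy : (star φ₀ ⬝ᵥ HF k₀ *ᵥ φ₀).re = estar := by
    change (star φ₀ ⬝ᵥ (A.submatrix (fun s => (s, k₀)) (fun s => (s, k₀))) *ᵥ φ₀).re = e₀ k₀
    rw [hφ₀eig, dotProduct_smul, hφ₀unit, smul_eq_mul, mul_one, Complex.ofReal_re]
  -- the trial state `Φ = φ₀ ⊗ |k₀⟩`
  set Φ : Index L Q8 → ℂ := fun ik => if ik.2 = k₀ then φ₀ ik.1 else 0 with hΦdef
  have hΦsupp : ∀ ik : Index L Q8, ik.1.card ≠ N → Φ ik = 0 := by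
    intro ik hik
    simp only [hΦdef]
    split_ifs
    · exact (mem_nParticleSubmodule_iff N φ₀).1 hφ₀W ik.1 hik
    · rfl
  have hΦunit : star Φ ⬝ᵥ Φ = 1 := by rw [hΦdef, star_dotProduct_single_self, hφ₀unit]
  set cE : ℝ := ((Fintype.card (Bond L) : ℂ) * (1 - 1 / (Fintype.card Q8 : ℂ))).re with hcEdef
  have hΦA : (star Φ ⬝ᵥ A *ᵥ Φ).re = estar := by
    rw [hAdiag, hΦdef, star_dotProduct_single_linkDiag_mulVec]
    exact hφ₀energy
  have hΦE : (star Φ ⬝ᵥ E' *ᵥ Φ).re = cE := by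
    rw [hE'def, hΦdef, star_dotProduct_one_kronecker_mulVec_single, hφ₀unit, mul_one, electric_apply_self]
  have hΦM : (star Φ ⬝ᵥ M' *ᵥ Φ).re = 0 := by
    rw [hM'def, hΦdef, star_dotProduct_one_kronecker_mulVec_single, hφ₀unit, mul_one]
    change (Matrix.diagonal (fun k => ∑ x : FermionTorus 2 L, plaquetteWeight Q8.rep (holonomy L k x)) k₀ k₀).re = 0
    rw [diagonal_apply_eq, q8_magnetic_diag_eq_zero_of_flat L k₀ hk₀flat, Complex.zero_re]
  have hΦenergy : ∀ g : ℝ, (star Φ ⬝ᵥ spinGaugedHubbardTorus L U g *ᵥ Φ).re = estar + g ^ 2 * cE := by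
    intro g
    rw [hHsplit g, add_mulVec, add_mulVec, dotProduct_add, dotProduct_add, Complex.add_re, Complex.add_re,
      smul_mulVec, smul_mulVec, dotProduct_smul, dotProduct_smul, smul_eq_mul, smul_eq_mul,
      Complex.re_ofReal_mul, Complex.re_ofReal_mul, hΦA, hΦE, hΦM]
    ring
  /- ───── lower bounds: `a₀ = E₀(A)` ───── -/
  set a₀ : ℝ := A.groundEnergy with ha₀
  have hAray : ∀ v : Index L Q8 → ℂ, a₀ * (star v ⬝ᵥ v).re ≤ (star v ⬝ᵥ A *ᵥ v).re := fun v =>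
    rayleigh_of_unit (p := fun _ : Index L Q8 => True)
      (fun w _ hw1 => Matrix.groundEnergy_le_rayleigh_holds hAherm w hw1) v (fun _ h => absurd trivial h)
  have hHFray : ∀ (k : Bond L → Q8) (v : Fock (Orb (FermionTorus 2 L))),
      a₀ * (star v ⬝ᵥ v).re ≤ (star v ⬝ᵥ HF k *ᵥ v).re := fun k v =>
    groundEnergy_gaugeFermion_le_rayleigh_frozen Q8.rep L hρ U k v
  have ha₀le : a₀ ≤ estar := by
    have h := hAray Φ
    rw [hΦunit, Complex.one_re, mul_one, hΦA] at h
    exact h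
  have hsector : ∀ (k : Bond L → Q8) (v : Fock (Orb (FermionTorus 2 L))), v ∈ W →
      e₀ k * (star v ⬝ᵥ v).re ≤ (star v ⬝ᵥ HF k *ᵥ v).re := fun k v hv =>
    frozen_minEnergyOn_le_rayleigh Q8.rep L hρ U k hN v hv
  /- ───── the sequence of couplings and block ground states ───── -/
  set gs : ℕ → ℝ := fun n => g₀ / ((n : ℝ) + 2) with hgsdef
  have hgpos : ∀ n, 0 < gs n := fun n => div_pos hg₀ (by positivity)
  have hgle : ∀ n, gs n ≤ g₀ := fun n => by
    rw [hgsdef]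
    exact div_le_self hg₀.le (by linarith [(Nat.cast_nonneg n : (0 : ℝ) ≤ n)])
  have hgs0 : Tendsto gs atTop (𝓝 0) := by
    have h1 : Tendsto (fun n : ℕ => (n : ℝ) + 2) atTop atTop :=
      tendsto_atTop_add_const_right _ _ tendsto_natCast_atTop_atTop
    exact tendsto_const_nhds.div_atTop h1
  -- block ground states
  have hGS : ∀ n, ∃ Ψ : Index L Q8 → ℂ, (∀ ik : Index L Q8, ik.1.card ≠ N → Ψ ik = 0) ∧
      star Ψ ⬝ᵥ Ψ = 1 ∧ ∃ E : ℝ, spinGaugedHubbardTorus L U (gs n) *ᵥ Ψ = (E : ℂ) • Ψ ∧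
        ∀ Φ' : Index L Q8 → ℂ, (∀ ik : Index L Q8, ik.1.card ≠ N → Φ' ik = 0) →
          E * (star Φ' ⬝ᵥ Φ').re ≤ (star Φ' ⬝ᵥ spinGaugedHubbardTorus L U (gs n) *ᵥ Φ').re := fun n =>
    exists_groundState_cardBlock Q8.rep L hρ U _ _ hN
  choose Ψ hΨsupp hΨunit E hΨeig hΨray using hGS
  /- ───── the corridor hypothesis on the sequence: pair order `≥ c' L⁴` ───── -/
  have horder : ∀ n, c' * (L : ℝ) ^ 4 ≤ (star (Ψ n) ⬝ᵥ (Pᴴ * P) *ᵥ Ψ n).re := by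
    intro n
    have hCn := hC (gs n) (hgpos n) (hgle n) L hL hEven (fun a => Ψ n a.1)
    -- the block vector is a ground state of the block
    have hsupp' : ∀ ik : Index L Q8, ¬ HasParticleNumber L N ik → Ψ n ik = 0 := fun ik h => hΨsupp n ik h
    have hne : (fun a : {ik : Index L Q8 // HasParticleNumber L N ik} => Ψ n a.1) ≠ 0 := by
      intro h0
      have hext := extend_restrict (HasParticleNumber L N) (Ψ n) hsupp'
      have hzero : Ψ n = 0 := by
        rw [← hext]
        funext b
        by_cases hb : HasParticleNumber L N b
        · have := congrFun h0 ⟨b, hb⟩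
          simpa [hb] using this
        · simp [hb]
      have h1 := hΨunit n
      rw [hzero, dotProduct_zero] at h1
      exact zero_ne_one h1
    have heig' : (spinGaugedHubbardTorus L U (gs n)).toBlock (HasParticleNumber L N) (HasParticleNumber L N) *ᵥ
        (fun a : {ik : Index L Q8 // HasParticleNumber L N ik} => Ψ n a.1) =
        ((E n : ℝ) : ℂ) • (fun a : {ik : Index L Q8 // HasParticleNumber L N ik} => Ψ n a.1) := by
      rw [toBlock_mulVec_restrict _ _ _ hsupp', hΨeig n]
      rfl
    have hray' : ∀ φ : {ik : Index L Q8 // HasParticleNumber L N ik} → ℂ,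
        E n * (star φ ⬝ᵥ φ).re ≤ (star φ ⬝ᵥ (spinGaugedHubbardTorus L U (gs n)).toBlock
          (HasParticleNumber L N) (HasParticleNumber L N) *ᵥ φ).re := by
      intro φ
      set v : Index L Q8 → ℂ := fun b => if h : HasParticleNumber L N b then φ ⟨b, h⟩ else 0 with hv
      have hvsupp : ∀ ik : Index L Q8, ¬ HasParticleNumber L N ik → v ik = 0 := fun ik hik => by
        simp [hv, hik]
      have hφv : φ = fun a : {ik : Index L Q8 // HasParticleNumber L N ik} => v a.1 :=
        (restrict_extend (HasParticleNumber L N) φ).symm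
      rw [hφv, star_restrict_dotProduct_toBlock_mulVec _ _ _ hvsupp,
        star_restrict_dotProduct_restrict _ _ _ hvsupp]
      exact hΨray n v (fun ik hik => hvsupp ik hik)
    have h := hCn ⟨hne, E n, heig', hray'⟩
    rwa [star_restrict_dotProduct_restrict _ _ _ hsupp', star_restrict_dotProduct_toBlock_mulVec _ _ _ hsupp',
      hΨunit n, Complex.one_re, mul_one] at h
  /- ───── the energy sandwich at step `n` ───── -/
  -- constants
  set C₁ : ℝ := estar - a₀ + g₀ ^ 2 * |cE| with hC₁
  set C₂ : ℝ := |cE| + (estar - a₀) * C₁ with hC₂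
  have hC₁nonneg : 0 ≤ C₁ := by
    have : 0 ≤ g₀ ^ 2 * |cE| := by positivity
    linarith
  -- energy identity and bounds
  have hsand : ∀ n, (star (Ψ n) ⬝ᵥ A *ᵥ Ψ n).re + (gs n) ^ 2 * (star (Ψ n) ⬝ᵥ E' *ᵥ Ψ n).re +
      (1 / (gs n) ^ 2) * (star (Ψ n) ⬝ᵥ M' *ᵥ Ψ n).re ≤ estar + (gs n) ^ 2 * cE := by
    intro n
    have hE : (star (Ψ n) ⬝ᵥ spinGaugedHubbardTorus L U (gs n) *ᵥ Ψ n).re = E n := by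
      rw [hΨeig n, dotProduct_smul, hΨunit n, smul_eq_mul, mul_one, Complex.ofReal_re]
    have hup : E n ≤ estar + (gs n) ^ 2 * cE := by
      have h := hΨray n Φ hΦsupp
      rw [hΦunit, Complex.one_re, mul_one, hΦenergy] at h
      exact h
    have hsplit : (star (Ψ n) ⬝ᵥ spinGaugedHubbardTorus L U (gs n) *ᵥ Ψ n).re =
        (star (Ψ n) ⬝ᵥ A *ᵥ Ψ n).re + (gs n) ^ 2 * (star (Ψ n) ⬝ᵥ E' *ᵥ Ψ n).re +
          (1 / (gs n) ^ 2) * (star (Ψ n) ⬝ᵥ M' *ᵥ Ψ n).re := by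
      rw [hHsplit (gs n), add_mulVec, add_mulVec, dotProduct_add, dotProduct_add, Complex.add_re,
        Complex.add_re, smul_mulVec, smul_mulVec, dotProduct_smul, dotProduct_smul, smul_eq_mul,
        smul_eq_mul, Complex.re_ofReal_mul, Complex.re_ofReal_mul]
    linarith
  have hEnonneg : ∀ n, 0 ≤ (star (Ψ n) ⬝ᵥ E' *ᵥ Ψ n).re := fun n => re_electric_form_nonneg L (Ψ n)
  have hMnonneg : ∀ n, 0 ≤ (star (Ψ n) ⬝ᵥ M' *ᵥ Ψ n).re := fun n => q8_re_magnetic_form_nonneg L (Ψ n)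
  have hAlow : ∀ n, a₀ ≤ (star (Ψ n) ⬝ᵥ A *ᵥ Ψ n).re := by
    intro n
    have h := hAray (Ψ n)
    rw [hΨunit n, Complex.one_re, mul_one] at h
    exact h
  -- (i) the magnetic form, hence the non-flat weight, is `O(g²)`
  have hMbound : ∀ n, (star (Ψ n) ⬝ᵥ M' *ᵥ Ψ n).re ≤ (gs n) ^ 2 * C₁ := by
    intro n
    have hg2 : 0 < (gs n) ^ 2 := pow_pos (hgpos n) 2
    have h1 := hsand n
    have h2 := hEnonneg n
    have h3 := hAlow n
    have hcE : (gs n) ^ 2 * cE ≤ g₀ ^ 2 * |cE| := by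
      have : (gs n) ^ 2 ≤ g₀ ^ 2 := by
        have := hgle n
        have := (hgpos n).le
        nlinarith
      nlinarith [le_abs_self cE, abs_nonneg cE]
    -- `(1/g²) M ≤ e⋆ + g² cE - a₀ - g² E ≤ C₁`
    have h4 : (1 / (gs n) ^ 2) * (star (Ψ n) ⬝ᵥ M' *ᵥ Ψ n).re ≤ C₁ := by
      have : 0 ≤ (gs n) ^ 2 * (star (Ψ n) ⬝ᵥ E' *ᵥ Ψ n).re := mul_nonneg hg2.le h2
      linarith
    have h5 := mul_le_mul_of_nonneg_left h4 hg2.le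
    rwa [← mul_assoc, mul_one_div_cancel hg2.ne', one_mul] at h5
  have hNFbound : ∀ n, ∑ k ∈ Finset.univ.filter (fun k : Bond L → Q8 => ¬ ∀ x, holonomy L k x = 1),
      (star (fun s => Ψ n (s, k)) ⬝ᵥ fun s => Ψ n (s, k)).re ≤ (gs n) ^ 2 * C₁ := fun n =>
    (q8_sum_nonflat_norm_sq_le_magnetic_form L (Ψ n)).trans (hMbound n)
  -- (ii) the flat defect is `O(g²)`
  have hΨkW : ∀ n k, (fun s => Ψ n (s, k)) ∈ W := fun n k =>
    (mem_nParticleSubmodule_iff N _).2 fun s hs => hΨsupp n (s, k) hs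
  have hDbound : ∀ n, ∑ k ∈ Finset.univ.filter (fun k : Bond L → Q8 => ∀ x, holonomy L k x = 1),
      ((star (fun s => Ψ n (s, k)) ⬝ᵥ HF k *ᵥ (fun s => Ψ n (s, k))).re -
        estar * (star (fun s => Ψ n (s, k)) ⬝ᵥ fun s => Ψ n (s, k)).re) ≤ (gs n) ^ 2 * C₂ := by
    intro n
    rw [Finset.sum_sub_distrib, ← Finset.mul_sum]
    set FL := Finset.univ.filter (fun k : Bond L → Q8 => ∀ x, holonomy L k x = 1) with hFL
    set NF := Finset.univ.filter (fun k : Bond L → Q8 => ¬ ∀ x, holonomy L k x = 1) with hNF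
    set aA : (Bond L → Q8) → ℝ := fun k =>
      (star (fun s => Ψ n (s, k)) ⬝ᵥ HF k *ᵥ (fun s => Ψ n (s, k))).re with haA
    set nn : (Bond L → Q8) → ℝ := fun k => (star (fun s => Ψ n (s, k)) ⬝ᵥ fun s => Ψ n (s, k)).re with hnn
    have hsumA : Finset.sum Finset.univ aA = Finset.sum FL aA + Finset.sum NF aA :=
      (Finset.sum_filter_add_sum_filter_not _ _ _).symm
    have hsumN : Finset.sum Finset.univ nn = Finset.sum FL nn + Finset.sum NF nn :=
      (Finset.sum_filter_add_sum_filter_not _ _ _).symm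
    have htotA : Finset.sum Finset.univ aA ≤ estar + (gs n) ^ 2 * cE := by
      have h1 := hsand n
      have h2 := hEnonneg n
      have h3 := hMnonneg n
      have hg2 : 0 < (gs n) ^ 2 := pow_pos (hgpos n) 2
      have h4 : 0 ≤ (1 / (gs n) ^ 2) * (star (Ψ n) ⬝ᵥ M' *ᵥ Ψ n).re :=
        mul_nonneg (one_div_pos.2 hg2).le h3
      have h5 : 0 ≤ (gs n) ^ 2 * (star (Ψ n) ⬝ᵥ E' *ᵥ Ψ n).re := mul_nonneg hg2.le h2
      have h6 : (star (Ψ n) ⬝ᵥ A *ᵥ Ψ n).re = Finset.sum Finset.univ aA := hformA (Ψ n)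
      linarith
    have htotN : Finset.sum Finset.univ nn = 1 := by rw [← hnorm (Ψ n), hΨunit n, Complex.one_re]
    have hNFA : a₀ * Finset.sum NF nn ≤ Finset.sum NF aA := by
      rw [Finset.mul_sum]
      exact Finset.sum_le_sum fun k _ => hHFray k _
    have hNFle : Finset.sum NF nn ≤ (gs n) ^ 2 * C₁ := hNFbound n
    have hcE : (gs n) ^ 2 * cE ≤ (gs n) ^ 2 * |cE| :=
      mul_le_mul_of_nonneg_left (le_abs_self cE) (sq_nonneg (gs n))
    have hes : 0 ≤ estar - a₀ := by linarith
    have hprod : (estar - a₀) * Finset.sum NF nn ≤ (estar - a₀) * ((gs n) ^ 2 * C₁) :=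
      mul_le_mul_of_nonneg_left hNFle hes
    have hC₂' : (gs n) ^ 2 * C₂ = (gs n) ^ 2 * |cE| + (estar - a₀) * ((gs n) ^ 2 * C₁) := by
      rw [hC₂]
      ring
    have hFLnn : Finset.sum FL nn = 1 - Finset.sum NF nn := by linarith
    have hmul1 : estar * Finset.sum FL nn = estar - estar * Finset.sum NF nn := by
      rw [hFLnn]
      ring
    have hmul2 : (estar - a₀) * Finset.sum NF nn = estar * Finset.sum NF nn - a₀ * Finset.sum NF nn := by
      ring
    rw [hC₂']
    linarith

  /- ───── compactness: a convergent subsequence of the block ground states ───── -/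
  have hmem : ∀ n, Ψ n ∈ {v : Index L Q8 → ℂ | (∀ ik, ¬ (ik.1.card = N) → v ik = 0) ∧ star v ⬝ᵥ v = 1} :=
    fun n => ⟨fun ik hik => hΨsupp n ik hik, hΨunit n⟩
  obtain ⟨a, ha, σ, hσ, hlim⟩ := (isCompact_unitSector (fun ik : Index L Q8 => ik.1.card = N)).tendsto_subseq hmem
  obtain ⟨hasupp, haunit⟩ := ha
  have hg2lim : Tendsto (fun n => (gs n) ^ 2) atTop (𝓝 0) := by
    simpa using hgs0.pow 2
  -- continuity of the component quadratic forms
  have hcontk : ∀ (k : Bond L → Q8) (X : Matrix (Finset (Orb (FermionTorus 2 L))) (Finset (Orb (FermionTorus 2 L))) ℂ),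
      Continuous fun v : Index L Q8 → ℂ => (star (fun s => v (s, k)) ⬝ᵥ X *ᵥ (fun s => v (s, k))).re :=
    fun k X => (EigenvalueContinuation.continuous_energy X).comp (continuous_pi fun s => continuous_apply (s, k))
  have hcontn : ∀ k : Bond L → Q8,
      Continuous fun v : Index L Q8 → ℂ => (star (fun s => v (s, k)) ⬝ᵥ (fun s => v (s, k))).re := by
    intro k
    have h := hcontk k 1
    simp only [one_mulVec] at h
    exact h
  -- (a) `a` vanishes off the flat configurations
  have haNF : ∀ k : Bond L → Q8, (¬ ∀ x, holonomy L k x = 1) → (fun s => a (s, k)) = 0 := by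
    intro k hk
    have hle : (star (fun s => a (s, k)) ⬝ᵥ (fun s => a (s, k))).re ≤ 0 := by
      refine le_of_tendsto_of_le (F := fun v : Index L Q8 → ℂ => (star (fun s => v (s, k)) ⬝ᵥ
        (fun s => v (s, k))).re) (hcontn k) (u := fun n => (gs n) ^ 2 * C₁) (fun n => ?_) ?_ hσ hlim
      · refine le_trans ?_ (hNFbound n)
        exact Finset.single_le_sum (f := fun k' => (star (fun s => Ψ n (s, k')) ⬝ᵥ fun s => Ψ n (s, k')).re)
          (fun k' _ => EigenvalueContinuation.re_star_dotProduct_self_nonneg _)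
          (Finset.mem_filter.2 ⟨Finset.mem_univ _, hk⟩)
      · simpa using hg2lim.mul_const C₁
    by_contra hne
    have hpos := EigenvalueContinuation.re_star_dotProduct_self_pos hne
    linarith
  -- (b) every flat defect term of `a` vanishes
  have hakW : ∀ k, (fun s => a (s, k)) ∈ W := fun k =>
    (mem_nParticleSubmodule_iff N _).2 fun s hs => hasupp (s, k) hs
  have haD : ∀ k : Bond L → Q8, (∀ x, holonomy L k x = 1) →
      (star (fun s => a (s, k)) ⬝ᵥ HF k *ᵥ (fun s => a (s, k))).re ≤
        estar * (star (fun s => a (s, k)) ⬝ᵥ fun s => a (s, k)).re := by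
    intro k hk
    set FL := Finset.univ.filter (fun k : Bond L → Q8 => ∀ x, holonomy L k x = 1) with hFL
    have hTcont : Continuous fun v : Index L Q8 → ℂ => ∑ k' ∈ FL,
        ((star (fun s => v (s, k')) ⬝ᵥ HF k' *ᵥ (fun s => v (s, k'))).re -
          estar * (star (fun s => v (s, k')) ⬝ᵥ fun s => v (s, k')).re) :=
      continuous_finsetSum FL fun k' _ => (hcontk k' (HF k')).sub (continuous_const.mul (hcontn k'))
    have hDa : ∑ k' ∈ FL, ((star (fun s => a (s, k')) ⬝ᵥ HF k' *ᵥ (fun s => a (s, k'))).re -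
        estar * (star (fun s => a (s, k')) ⬝ᵥ fun s => a (s, k')).re) ≤ 0 := by
      refine le_of_tendsto_of_le (F := fun v : Index L Q8 → ℂ => ∑ k' ∈ FL,
        ((star (fun s => v (s, k')) ⬝ᵥ HF k' *ᵥ (fun s => v (s, k'))).re -
          estar * (star (fun s => v (s, k')) ⬝ᵥ fun s => v (s, k')).re)) hTcont
        (u := fun n => (gs n) ^ 2 * C₂) (fun n => hDbound n) ?_ hσ hlim
      simpa using hg2lim.mul_const C₂
    have hTnonneg : ∀ k' ∈ FL, 0 ≤ (star (fun s => a (s, k')) ⬝ᵥ HF k' *ᵥ (fun s => a (s, k'))).re -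
        estar * (star (fun s => a (s, k')) ⬝ᵥ fun s => a (s, k')).re := by
      intro k' hk'
      have hflat := (Finset.mem_filter.1 hk').2
      have h1 := hsector k' _ (hakW k')
      have h2 := hk₀min k' hflat
      have h3 := EigenvalueContinuation.re_star_dotProduct_self_nonneg (fun s => a (s, k'))
      have h4 := mul_le_mul_of_nonneg_right h2 h3
      linarith
    have hzero := le_antisymm hDa (Finset.sum_nonneg hTnonneg)
    have hk' := (Finset.sum_eq_zero_iff_of_nonneg hTnonneg).1 hzero k
      (Finset.mem_filter.2 ⟨Finset.mem_univ _, hk⟩)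
    linarith
  -- (c) the pair order of `a`
  have haorder : c' * (L : ℝ) ^ 4 ≤ (star a ⬝ᵥ (Pᴴ * P) *ᵥ a).re :=
    ge_of_tendsto_of_ge (F := fun v : Index L Q8 → ℂ => (star v ⬝ᵥ (Pᴴ * P) *ᵥ v).re)
      (EigenvalueContinuation.continuous_energy _) (u := fun _ => c' * (L : ℝ) ^ 4) horder
      tendsto_const_nhds hσ hlim
  /- ───── the qualifying block ───── -/
  have hanorm : ∑ k, (star (fun s => a (s, k)) ⬝ᵥ (fun s => a (s, k))).re = 1 := by
    rw [← hnorm, haunit, Complex.one_re]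
  obtain ⟨k, hak, hordk⟩ : ∃ k : Bond L → Q8, (fun s => a (s, k)) ≠ 0 ∧
      c' * (L : ℝ) ^ 4 * (star (fun s => a (s, k)) ⬝ᵥ (fun s => a (s, k))).re ≤
        (star (fun s => a (s, k)) ⬝ᵥ ((PF k)ᴴ * PF k) *ᵥ (fun s => a (s, k))).re := by
    by_contra hno
    push Not at hno
    -- every block term is `≤ 0` and one of them is `< 0`, yet the sum is `≥ 0`
    set t : (Bond L → Q8) → ℝ := fun k =>
      (star (fun s => a (s, k)) ⬝ᵥ ((PF k)ᴴ * PF k) *ᵥ (fun s => a (s, k))).re -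
        c' * (L : ℝ) ^ 4 * (star (fun s => a (s, k)) ⬝ᵥ (fun s => a (s, k))).re with ht
    have htle : ∀ k, t k ≤ 0 := by
      intro k
      by_cases hk : (fun s => a (s, k)) = 0
      · simp [ht, hk]
      · have := hno k hk
        simp only [ht]
        linarith
    obtain ⟨k₁, hk₁⟩ : ∃ k₁, (fun s => a (s, k₁)) ≠ 0 := by
      by_contra hall
      push Not at hall
      have : ∑ k, (star (fun s => a (s, k)) ⬝ᵥ (fun s => a (s, k))).re = 0 :=
        Finset.sum_eq_zero fun k _ => by rw [hall k]; simp
      rw [hanorm] at this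
      exact one_ne_zero this
    have hlt : t k₁ < 0 := by
      have := hno k₁ hk₁
      simp only [ht]
      linarith
    have hsum : ∑ k, t k < 0 := by
      have h := Finset.sum_lt_sum (s := Finset.univ) (f := t) (g := fun _ => (0 : ℝ))
        (fun k _ => htle k) ⟨k₁, Finset.mem_univ _, by simpa using hlt⟩
      simpa using h
    have hsum' : ∑ k, t k = (star a ⬝ᵥ (Pᴴ * P) *ᵥ a).re - c' * (L : ℝ) ^ 4 * 1 := by
      simp only [ht]
      rw [Finset.sum_sub_distrib, ← hformPP, ← Finset.mul_sum, hanorm]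
    rw [hsum'] at hsum
    linarith
  /- ───── conclusion ───── -/
  have hkflat : ∀ x, holonomy L k x = 1 := by
    by_contra hk
    exact hak (haNF k hk)
  have hnk : 0 < (star (fun s => a (s, k)) ⬝ᵥ fun s => a (s, k)).re :=
    EigenvalueContinuation.re_star_dotProduct_self_pos hak
  have hDk := haD k hkflat
  have hSk := hsector k _ (hakW k)
  have hmink := hk₀min k hkflat
  have he : e₀ k = estar := by
    refine le_antisymm ?_ hmink
    exact le_of_mul_le_mul_right (hSk.trans hDk) hnk
  have hHFherm : (HF k)ᴴ = HF k := (hAherm.submatrix fun s => (s, k)).eq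
  have heig : HF k *ᵥ (fun s => a (s, k)) = ((e₀ k : ℝ) : ℂ) • (fun s => a (s, k)) := by
    refine EigenvalueContinuation.mulVec_eq_smul_of_forall_le_on hHFherm W (fun v hv => ?_)
      (fun v hv => hsector k v hv) (hakW k) ?_
    · exact submatrix_mulVec_mem_nParticleSubmodule Q8.rep L U 0 0 k hv
    · rw [he]
      exact hDk
  refine ⟨k, ⟨hkflat, fun k' hk' => ?_⟩, fun s => a (s, k), ⟨hakW k, hak, heig⟩, hordk⟩
  rw [he]
  exact hk₀min k' hk'

end SpinGauged

end Literature.MathematicalPhysics.QuantumLattice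

end
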